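import Mathlib
import Literature.NumberTheory.Transcendental.KontsevichZagierGammaProofs
import Literature.Barriers.Schanuel.NesterenkoModularScopeConjectureProofs
import Summits.KontsevichZagierPeriods.KontsevichZagierPeriods.Theorems.GrothendieckKEAlgIndependent

/-!
# `TateLifting` (stmt-KontsevichZagierPeriods-9129), line `Sketch` — stub 34 `tateLifting_betaThirdPiAlgIndependent`

EQUIANHARMONIC INPUT of the transcendental sector of the crux `TateLifting` (kernel form of the
Kontsevich–Zagier period conjecture, route `InverseLandau`): the Beta value
`B := B(1/3, 1/3) = ∫₀¹ t^{-2/3} (1 − t)^{-2/3} dt = Γ(1/3)² / Γ(2/3)`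
(`ProbabilityTheory.beta ↑(1/3) ↑(1/3)`) and `π` are algebraically independent over `ℚ`.

## Proof

Put `F := ℚ(B, π) ⊆ ℝ`.

* By definition `ProbabilityTheory.beta α β = Γ(α) Γ(β) / Γ(α + β)`, so `B = Γ(1/3)² / Γ(2/3)`.
* Euler's reflection formula `Γ(s) Γ(1 − s) = π / sin (π s)` (`Real.Gamma_mul_Gamma_one_sub`) at
  `s = 1/3` with `sin (π/3) = √3/2` (`Real.sin_pi_div_three`) gives `Γ(1/3) Γ(2/3) = 2π/√3`,
  hence `Γ(1/3)³ = B · Γ(1/3) Γ(2/3) = 2πB/√3` and `Γ(1/3)⁶ = 4π²B²/3 ∈ F`; so `Γ(1/3)` is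
  algebraic over `F` (`IsAlgebraic.of_pow`).
* Hence `trdeg_ℚ F(π, Γ(1/3)) = trdeg_ℚ F`
  (`Literature.Barriers.Schanuel.trdeg_adjoin_union_eq_of_isAlgebraic_adjoin`).
* Chudnovsky (1976): `π`, `Γ(1/3)` are algebraically independent over `ℚ`
  (`Literature.NumberTheory.Transcendental.algebraicIndependent_real_pi_gamma_one_third`), so
  `2 ≤ trdeg_ℚ F(π, Γ(1/3))`
  (`Summit.KontsevichZagierPeriods.Grothendieck.le_trdeg_adjoin_of_algebraicIndependent`).
* `2 ≤ trdeg_ℚ ℚ(B, π)` forces `![B, π]` algebraically independent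
  (`Literature.Barriers.Schanuel.algebraicIndependent_of_le_trdeg_adjoin`).

References: G. V. Chudnovsky, *Contributions to the theory of transcendental numbers* (1984),
Ch. 7 §2 Cor. 2.3; M. Waldschmidt, *Elliptic functions and transcendence* (2008), §5.2 Cor. 33.
-/

noncomputable section

open IntermediateField

namespace Summit.KontsevichZagierPeriods.InverseLandau

open Literature.NumberTheory.Transcendental
open Summit.KontsevichZagierPeriods.Grothendieck (le_trdeg_adjoin_of_algebraicIndependent)

/-- **Reflection at `1/3`:** `Γ(1/3) Γ(2/3) = 2π/√3` (Euler's reflection formula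
`Γ(s) Γ(1 − s) = π / sin (π s)` at `s = 1/3`, `sin (π/3) = √3/2`). [folklore] -/
theorem gamma_one_third_mul_gamma_two_thirds :
    Real.Gamma (1 / 3) * Real.Gamma (2 / 3) = 2 * Real.pi / Real.sqrt 3 := by
  have h := Real.Gamma_mul_Gamma_one_sub (1 / 3 : ℝ)
  have h13 : (1 : ℝ) - 1 / 3 = 2 / 3 := by norm_num
  have hsin : Real.sin (Real.pi * (1 / 3)) = Real.sqrt 3 / 2 := by
    rw [show Real.pi * (1 / 3) = Real.pi / 3 by ring]
    exact Real.sin_pi_div_three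
  rw [h13, hsin] at h
  rw [h]
  have h3 : Real.sqrt 3 ≠ 0 := by positivity
  field_simp

/-- **The Beta value `B(1/3, 1/3)`:** `B(1/3, 1/3) = Γ(1/3)² / Γ(2/3)`
(`ProbabilityTheory.beta α β = Γ(α) Γ(β) / Γ(α + β)` by definition). [folklore] -/
theorem beta_one_third_one_third_eq :
    ProbabilityTheory.beta ((1 / 3 : ℚ) : ℝ) ((1 / 3 : ℚ) : ℝ) =
      Real.Gamma (1 / 3) ^ 2 / Real.Gamma (2 / 3) := by
  have hcast : ((1 / 3 : ℚ) : ℝ) = 1 / 3 := by norm_num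
  rw [hcast, ProbabilityTheory.beta, show (1 : ℝ) / 3 + 1 / 3 = 2 / 3 by norm_num, sq]

/-- **`Γ(1/3)⁶ = 4π² B(1/3,1/3)² / 3`** (from `B = Γ(1/3)²/Γ(2/3)` and the reflection formula
`Γ(1/3) Γ(2/3) = 2π/√3`: `Γ(1/3)³ = 2πB/√3`). [folklore] -/
theorem gamma_one_third_pow_six_eq :
    Real.Gamma (1 / 3) ^ 6 =
      4 * Real.pi ^ 2 * ProbabilityTheory.beta ((1 / 3 : ℚ) : ℝ) ((1 / 3 : ℚ) : ℝ) ^ 2 / 3 := by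
  have hΓ23 : Real.Gamma (2 / 3) ≠ 0 := (Real.Gamma_pos_of_pos (by norm_num)).ne'
  have hsqrt3 : Real.sqrt 3 ^ 2 = 3 := Real.sq_sqrt (by norm_num)
  have hG3 : Real.Gamma (1 / 3) ^ 3 =
      ProbabilityTheory.beta ((1 / 3 : ℚ) : ℝ) ((1 / 3 : ℚ) : ℝ) * (2 * Real.pi / Real.sqrt 3) := by
    rw [← gamma_one_third_mul_gamma_two_thirds, beta_one_third_one_third_eq]
    field_simp
  calc Real.Gamma (1 / 3) ^ 6 = (Real.Gamma (1 / 3) ^ 3) ^ 2 := by ring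
    _ = (ProbabilityTheory.beta ((1 / 3 : ℚ) : ℝ) ((1 / 3 : ℚ) : ℝ) *
          (2 * Real.pi / Real.sqrt 3)) ^ 2 := by rw [hG3]
    _ = 4 * Real.pi ^ 2 * ProbabilityTheory.beta ((1 / 3 : ℚ) : ℝ) ((1 / 3 : ℚ) : ℝ) ^ 2 / 3 := by
        rw [mul_pow, div_pow, mul_pow, hsqrt3]
        ring

/-- **`B(1/3, 1/3)` and `π` are algebraically independent over `ℚ`** (stub 34
`tateLifting_betaThirdPiAlgIndependent` of the line `Sketch` of the crux `TateLifting`,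
stmt-KontsevichZagierPeriods-9129). With `F = ℚ(B, π)`, `B = Γ(1/3)²/Γ(2/3)` and the reflection
formula `Γ(1/3) Γ(2/3) = 2π/√3` put `Γ(1/3)⁶ = 4π²B²/3 ∈ F`, so `Γ(1/3)` is algebraic over `F` and
`trdeg_ℚ F = trdeg_ℚ F(π, Γ(1/3)) ≥ 2` by Chudnovsky's theorem (`π`, `Γ(1/3)` algebraically
independent, tree theorem `algebraicIndependent_real_pi_gamma_one_third`); a pair generating a
field of transcendence degree `≥ 2` is algebraically independent.
[cite: Chudnovsky1984, Ch. 7 §2 Corollary 2.3] -/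
theorem tateLifting_betaThirdPiAlgIndependent :
    AlgebraicIndependent ℚ ![ProbabilityTheory.beta ((1 / 3 : ℚ) : ℝ) ((1 / 3 : ℚ) : ℝ), Real.pi] := by
  set B : ℝ := ProbabilityTheory.beta ((1 / 3 : ℚ) : ℝ) ((1 / 3 : ℚ) : ℝ) with hB_def
  have hG6 : Real.Gamma (1 / 3) ^ 6 = 4 * Real.pi ^ 2 * B ^ 2 / 3 := gamma_one_third_pow_six_eq
  set l : Fin 2 → ℝ := ![B, Real.pi]
  set S : Set ℝ := Set.range l
  set F : IntermediateField ℚ ℝ := adjoin ℚ S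
  have hBF : B ∈ F := subset_adjoin ℚ S ⟨0, rfl⟩
  have hpiF : Real.pi ∈ F := subset_adjoin ℚ S ⟨1, rfl⟩
  -- `Γ(1/3)⁶ = 4 π² B² / 3 ∈ F`
  have hG6F : Real.Gamma (1 / 3) ^ 6 ∈ F := by
    rw [hG6]
    exact div_mem (mul_mem (mul_mem (by exact_mod_cast F.natCast_mem 4) (pow_mem hpiF 2))
      (pow_mem hBF 2)) (by exact_mod_cast F.natCast_mem 3)
  -- `T = {π, Γ(1/3)}` is algebraic over `F`
  set T : Set ℝ := {Real.pi, Real.Gamma (1 / 3)}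
  have hTalg : ∀ x ∈ T, IsAlgebraic F x := by
    intro x hx
    rcases hx with rfl | rfl
    · exact isAlgebraic_algebraMap (⟨Real.pi, hpiF⟩ : F)
    · have h6 : IsAlgebraic F (Real.Gamma (1 / 3) ^ 6) :=
        isAlgebraic_algebraMap (⟨Real.Gamma (1 / 3) ^ 6, hG6F⟩ : F)
      exact h6.of_pow (by norm_num)
  -- Chudnovsky: `2 ≤ trdeg_ℚ ℚ(S ∪ T)`
  have hy : AlgebraicIndependent ℚ ![Real.pi, Real.Gamma (1 / 3)] :=
    algebraicIndependent_real_pi_gamma_one_third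
  have hyST : ∀ i, (![Real.pi, Real.Gamma (1 / 3)] : Fin 2 → ℝ) i ∈ adjoin ℚ (S ∪ T) := by
    intro i
    refine subset_adjoin ℚ (S ∪ T) (Or.inr ?_)
    fin_cases i
    · exact Or.inl rfl
    · exact Or.inr rfl
  have h2 := le_trdeg_adjoin_of_algebraicIndependent (S ∪ T) _ hy hyST
  -- transfer to `F = ℚ(S)` and conclude
  rw [Literature.Barriers.Schanuel.trdeg_adjoin_union_eq_of_isAlgebraic_adjoin S T hTalg] at h2
  exact Literature.Barriers.Schanuel.algebraicIndependent_of_le_trdeg_adjoin l h2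

end Summit.KontsevichZagierPeriods.InverseLandau

end
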